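import Summits.PneNP.PneNP.Theorems.KarlinRubinMonotoneBlindDepth3Resample
import Summits.PneNP.PneNP.Theorems.KarlinRubinMonotoneBlindDepth3Bad
import Summits.PneNP.PneNP.Theorems.KarlinRubinMonotoneBlindDnfBounds
import Mathlib.Analysis.SpecificLimits.Basic

/-!
# Route KarlinRubin, crux `MonotoneBlind` (stmt-PneNP-18027): depth 3 — averaging over the planted set

Probability form (`ℝ≥0∞`, laws `erdosRenyiHalf` and uniform `kSubsets`) of the counting lemmas of the depth-3 line
(seat write-up `MonotoneBlind_depth3_theorem.md`). Throughout, "avg" of an event `P A x` means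
`(#kSubsets)⁻¹ Σ_{A ∈ kSubsets} Pr_{G(n,1/2)}[P A x]`.

* `depth3_avg_le_of_forall` — Fubini for the finite product: if for every `x` the fraction of planted sets `A` with
  `P A x` is `≤ β`, then avg `≤ β`;
* `depth3_avg_encoding_le` — for a fixed input whose off-clauses have `≤ Lw` slots, the fraction of planted sets
  containing a minimal touching set of size `≥ z₀` is `≤ 2 (Lw d)^{z₀} / n^{z₀}` (`2 Lw d ≤ n`; encoding lemma +
  geometric series);
* `depth3_avg_bad₂_le`, `depth3_avg_rescue_big_le`, `depth3_prob_allOff_le` — the structure events in probability form.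

All `--supports stmt-PneNP-18027`; no definitions.
-/

set_option linter.dupNamespace false -- `Summit.PneNP.PneNP.…`: summit = sub-problem (D-0017)

namespace Summit.PneNP.PneNP.Theorems

open Finset
open scoped ENNReal
open Literature.Computability.Complexity
open Literature.Probability.RandomGraphs.PlantedClique

variable {n : ℕ}

/-! ### Fubini over the finite product -/

/-- `Pr_{G(n,1/2)}[P]` as a normalized sum of indicators. [folklore] -/
theorem erdosRenyiHalf_toOuterMeasure_eq_sum_div (P : EdgeVec n → Prop) [DecidablePred P] :
    (erdosRenyiHalf n).toOuterMeasure {x | P x} =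
      (∑ x : EdgeVec n, if P x then (1 : ℝ≥0∞) else 0) / (Fintype.card (EdgeVec n) : ℝ≥0∞) := by
  classical
  rw [erdosRenyiHalf_toOuterMeasure_eq_card_div]
  congr 1
  rw [Finset.sum_boole]
  congr 2

/-- **Fubini for the planted pair.** If for every input `x` the planted sets `A ∈ kSubsets` with `P A x` lie in a
set `T_x` of fraction at most `β`, then the average over `A` of `Pr_x[P A x]` is at most `β` (no decidability of `P`
is assumed: the sets `T_x` carry it). [folklore] -/
theorem depth3_avg_le_of_forall (k : ℕ) (P : Finset (Fin n) → EdgeVec n → Prop) (β : ℝ≥0∞)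
    (h : ∀ x : EdgeVec n, ∃ T : Finset (Finset (Fin n)), (∀ A ∈ kSubsets n k, P A x → A ∈ T) ∧
      ((#(kSubsets n k) : ℕ) : ℝ≥0∞)⁻¹ * ((#T : ℕ) : ℝ≥0∞) ≤ β) :
    ((#(kSubsets n k) : ℕ) : ℝ≥0∞)⁻¹ *
        ∑ A ∈ kSubsets n k, (erdosRenyiHalf n).toOuterMeasure {x | P A x} ≤ β := by
  classical
  set KS := kSubsets n k with hKS
  set K : ℝ≥0∞ := (Fintype.card (EdgeVec n) : ℝ≥0∞) with hK
  have hK0 : K ≠ 0 := by rw [hK]; exact_mod_cast Fintype.card_ne_zero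
  have hKtop : K ≠ ⊤ := ENNReal.natCast_ne_top _
  have hcount : ∀ x : EdgeVec n, ((#KS : ℕ) : ℝ≥0∞)⁻¹ * (∑ A ∈ KS, if P A x then (1 : ℝ≥0∞) else 0) ≤ β := by
    intro x
    obtain ⟨T, hT, hβ⟩ := h x
    refine le_trans ?_ hβ
    rw [Finset.sum_boole]
    gcongr
    exact fun A hA => hT A (mem_filter.1 hA).1 (mem_filter.1 hA).2
  calc ((#KS : ℕ) : ℝ≥0∞)⁻¹ * ∑ A ∈ KS, (erdosRenyiHalf n).toOuterMeasure {x | P A x}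
      = ((#KS : ℕ) : ℝ≥0∞)⁻¹ * ∑ A ∈ KS, (∑ x : EdgeVec n, if P A x then (1 : ℝ≥0∞) else 0) / K := by
        congr 1
        exact sum_congr rfl fun A _ => erdosRenyiHalf_toOuterMeasure_eq_sum_div (P A)
    _ = (∑ x : EdgeVec n, ((#KS : ℕ) : ℝ≥0∞)⁻¹ * ∑ A ∈ KS, if P A x then (1 : ℝ≥0∞) else 0) / K := by
        simp only [div_eq_mul_inv]
        rw [← sum_mul, ← mul_assoc, sum_comm, mul_sum]
    _ ≤ (∑ _x : EdgeVec n, β) / K := by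
        gcongr with x
        exact hcount x
    _ = β := by
        rw [sum_const, card_univ, nsmul_eq_mul, ← hK, mul_comm, mul_div_assoc,
          ENNReal.div_self hK0 hKtop, mul_one]

/-- An input-independent event has probability `≤ [Q]`. [folklore] -/
theorem erdosRenyiHalf_toOuterMeasure_const_le (Q : Prop) [Decidable Q] :
    (erdosRenyiHalf n).toOuterMeasure {_x : EdgeVec n | Q} ≤ if Q then 1 else 0 := by
  split_ifs with hQ
  · exact (MeasureTheory.OuterMeasure.mono _ (Set.subset_univ _)).trans_eq
      ((PMF.toOuterMeasure_apply_eq_one_iff _ _).2 (Set.subset_univ _))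
  · have : {_x : EdgeVec n | Q} = ∅ := Set.eq_empty_of_forall_notMem fun _ h => hQ h
    rw [this, MeasureTheory.measure_empty]

/-! ### Geometric tail -/

/-- `ℕ → ℝ≥0∞`: `a · e · 2^j ≤ c · b` gives `a / b ≤ (c / e) · 2⁻¹^j` (`b, e ≠ 0`). [folklore] -/
theorem natCast_div_le_div_mul_half_pow {a b c e j : ℕ} (h : a * e * 2 ^ j ≤ c * b) (hb : b ≠ 0) (he : e ≠ 0) :
    ((a : ℕ) : ℝ≥0∞) / ((b : ℕ) : ℝ≥0∞) ≤ ((c : ℕ) : ℝ≥0∞) / ((e : ℕ) : ℝ≥0∞) * (2⁻¹ : ℝ≥0∞) ^ j := by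
  have hb0 : ((b : ℕ) : ℝ≥0∞) ≠ 0 := by exact_mod_cast hb
  have he0 : ((e : ℕ) : ℝ≥0∞) ≠ 0 := by exact_mod_cast he
  have h2 : ((2 : ℝ≥0∞) ^ j) ≠ 0 := pow_ne_zero _ two_ne_zero
  have h2' : ((2 : ℝ≥0∞) ^ j) ≠ ⊤ := ENNReal.pow_ne_top ENNReal.ofNat_ne_top
  rw [ENNReal.div_le_iff hb0 (ENNReal.natCast_ne_top _)]
  -- multiply the target by `e · 2^j`
  have key : ((a : ℕ) : ℝ≥0∞) * (((e : ℕ) : ℝ≥0∞) * 2 ^ j) ≤ ((c : ℕ) : ℝ≥0∞) * ((b : ℕ) : ℝ≥0∞) := by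
    rw [← mul_assoc]; exact_mod_cast h
  calc ((a : ℕ) : ℝ≥0∞)
      = ((a : ℕ) : ℝ≥0∞) * (((e : ℕ) : ℝ≥0∞) * 2 ^ j) * (((e : ℕ) : ℝ≥0∞) * 2 ^ j)⁻¹ := by
        rw [mul_assoc, ENNReal.mul_inv_cancel (mul_ne_zero he0 h2)
          (ENNReal.mul_ne_top (ENNReal.natCast_ne_top _) h2'), mul_one]
    _ ≤ ((c : ℕ) : ℝ≥0∞) * ((b : ℕ) : ℝ≥0∞) * (((e : ℕ) : ℝ≥0∞) * 2 ^ j)⁻¹ := mul_le_mul' key le_rfl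
    _ = ((c : ℕ) : ℝ≥0∞) / ((e : ℕ) : ℝ≥0∞) * 2⁻¹ ^ j * ((b : ℕ) : ℝ≥0∞) := by
        rw [ENNReal.mul_inv (Or.inl he0) (Or.inl (ENNReal.natCast_ne_top _)), ENNReal.inv_pow,
          div_eq_mul_inv]
        ring

/-- **Geometric tail.** If `2 · q ≤ n` then `Σ_{z ∈ [z₀, zmax]} q^z / n^z ≤ 2 · q^{z₀} / n^{z₀}` (`0 < n`). [folklore] -/
theorem sum_Icc_pow_div_pow_le (hn : 0 < n) {q : ℕ} (hq : 2 * q ≤ n) (z₀ zmax : ℕ) :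
    ∑ z ∈ Icc z₀ zmax, ((q ^ z : ℕ) : ℝ≥0∞) / ((n ^ z : ℕ) : ℝ≥0∞) ≤
      2 * (((q ^ z₀ : ℕ) : ℝ≥0∞) / ((n ^ z₀ : ℕ) : ℝ≥0∞)) := by
  have hterm : ∀ z ∈ Icc z₀ zmax, ((q ^ z : ℕ) : ℝ≥0∞) / ((n ^ z : ℕ) : ℝ≥0∞) ≤
      ((q ^ z₀ : ℕ) : ℝ≥0∞) / ((n ^ z₀ : ℕ) : ℝ≥0∞) * (2⁻¹ : ℝ≥0∞) ^ (z - z₀) := by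
    intro z hz
    have hzz : z₀ ≤ z := (mem_Icc.1 hz).1
    refine natCast_div_le_div_mul_half_pow ?_ (pow_pos hn _).ne' (pow_pos hn _).ne'
    -- `q^z n^{z₀} 2^{z-z₀} ≤ q^{z₀} n^z`
    have h1 : q ^ (z - z₀) * 2 ^ (z - z₀) ≤ n ^ (z - z₀) := by
      rw [← mul_pow]; exact Nat.pow_le_pow_left (by omega) _
    calc q ^ z * n ^ z₀ * 2 ^ (z - z₀) = q ^ z₀ * n ^ z₀ * (q ^ (z - z₀) * 2 ^ (z - z₀)) := by
          rw [← Nat.sub_add_cancel hzz, pow_add, Nat.add_sub_cancel]; ring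
      _ ≤ q ^ z₀ * n ^ z₀ * n ^ (z - z₀) := Nat.mul_le_mul_left _ h1
      _ = q ^ z₀ * n ^ z := by rw [mul_assoc, ← pow_add, Nat.add_sub_cancel' hzz]
  calc ∑ z ∈ Icc z₀ zmax, ((q ^ z : ℕ) : ℝ≥0∞) / ((n ^ z : ℕ) : ℝ≥0∞)
      ≤ ∑ z ∈ Icc z₀ zmax, ((q ^ z₀ : ℕ) : ℝ≥0∞) / ((n ^ z₀ : ℕ) : ℝ≥0∞) * (2⁻¹ : ℝ≥0∞) ^ (z - z₀) :=
        sum_le_sum hterm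
    _ = ((q ^ z₀ : ℕ) : ℝ≥0∞) / ((n ^ z₀ : ℕ) : ℝ≥0∞) * ∑ z ∈ Icc z₀ zmax, (2⁻¹ : ℝ≥0∞) ^ (z - z₀) := by
        rw [mul_sum]
    _ ≤ ((q ^ z₀ : ℕ) : ℝ≥0∞) / ((n ^ z₀ : ℕ) : ℝ≥0∞) * 2 := by
        gcongr
        -- reindex and compare with the full geometric series
        have hre : ∑ z ∈ Icc z₀ zmax, (2⁻¹ : ℝ≥0∞) ^ (z - z₀) =
            ∑ j ∈ range (zmax + 1 - z₀), (2⁻¹ : ℝ≥0∞) ^ j := by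
          rw [← Finset.Ico_add_one_right_eq_Icc, Finset.sum_Ico_eq_sum_range]
          exact sum_congr rfl fun j _ => by rw [Nat.add_sub_cancel_left]
        rw [hre]
        calc ∑ j ∈ range (zmax + 1 - z₀), (2⁻¹ : ℝ≥0∞) ^ j ≤ ∑' j : ℕ, (2⁻¹ : ℝ≥0∞) ^ j :=
              ENNReal.sum_le_tsum _
          _ = 2 := ENNReal.tsum_geometric_two
    _ = 2 * (((q ^ z₀ : ℕ) : ℝ≥0∞) / ((n ^ z₀ : ℕ) : ℝ≥0∞)) := mul_comm _ _

/-! ### The encoding bound in probability form -/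

/-- **Encoding bound, averaged.** For a fixed input whose white-clause family `𝒲` has clauses of `≤ Lw` slots
(`1 ≤ Lw`, `2 Lw d ≤ n`, `d = min k n`): the fraction of planted sets containing a minimal touching set of size `≥ z₀`
is at most `2 (Lw d)^{z₀} / n^{z₀}`. [folklore] -/
theorem depth3_avg_encoding_le (hn : 0 < n) (𝒲 : Finset (Finset (⊤ : SimpleGraph (Fin n)).edgeSet))
    (τ : Finset (Fin n) → Prop) (hτ : ∀ Z, τ Z ↔ ∀ S ∈ 𝒲, ∃ e ∈ S, ∀ v ∈ (e : Sym2 (Fin n)), v ∈ Z)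
    (𝓜 : Finset (Finset (Fin n))) (h𝓜 : ∀ Z, Z ∈ 𝓜 ↔ τ Z ∧ ∀ v ∈ Z, ¬ τ (Z.erase v))
    {Lw : ℕ} (hLw : 1 ≤ Lw) (hW : ∀ S ∈ 𝒲, #S ≤ Lw) (k z₀ : ℕ) (hsmall : 2 * (Lw * min k n) ≤ n) :
    ((#(kSubsets n k) : ℕ) : ℝ≥0∞)⁻¹ *
        ((#((kSubsets n k).filter fun A => ∃ Z ∈ 𝓜, z₀ ≤ #Z ∧ Z ⊆ A) : ℕ) : ℝ≥0∞) ≤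
      2 * ((((Lw * min k n) ^ z₀ : ℕ) : ℝ≥0∞) / ((n ^ z₀ : ℕ) : ℝ≥0∞)) := by
  classical
  set KS := kSubsets n k with hKS
  set d := min k n with hd
  have hne := card_kSubsets_cast_ne_zero n k
  have htop : ((#KS : ℕ) : ℝ≥0∞) ≠ ⊤ := ENNReal.natCast_ne_top _
  -- slice by the size of the minimal touching set (at most `d`, being inside `A`)
  have hcover : (KS.filter fun A => ∃ Z ∈ 𝓜, z₀ ≤ #Z ∧ Z ⊆ A) ⊆
      (Icc z₀ d).biUnion fun z => KS.filter fun A => ∃ Z ∈ 𝓜, #Z = z ∧ Z ⊆ A := by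
    intro A hA
    rw [mem_filter] at hA
    obtain ⟨hAK, Z, hZ, hz₀, hZA⟩ := hA
    have hZd : #Z ≤ d := by
      rw [hd, ← card_of_mem_kSubsets (by rw [← hKS]; exact hAK)]; exact card_le_card hZA
    exact mem_biUnion.2 ⟨#Z, mem_Icc.2 ⟨hz₀, hZd⟩, mem_filter.2 ⟨hAK, Z, hZ, rfl, hZA⟩⟩
  have hslice : ∀ z, ((#KS : ℕ) : ℝ≥0∞)⁻¹ *
      ((#(KS.filter fun A => ∃ Z ∈ 𝓜, #Z = z ∧ Z ⊆ A) : ℕ) : ℝ≥0∞) ≤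
        (((Lw * d) ^ z : ℕ) : ℝ≥0∞) / ((n ^ z : ℕ) : ℝ≥0∞) := by
    intro z
    have hcnt := depth3_card_kSubsets_superset_minimal_mul_le 𝒲 τ hτ 𝓜 h𝓜 hLw hW k z
    rw [← hKS, ← hd] at hcnt
    have hnz : ((n ^ z : ℕ) : ℝ≥0∞) ≠ 0 := by exact_mod_cast (pow_pos hn z).ne'
    rw [ENNReal.le_div_iff_mul_le (Or.inl hnz) (Or.inl (ENNReal.natCast_ne_top _)), mul_assoc]
    calc ((#KS : ℕ) : ℝ≥0∞)⁻¹ *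
          (((#(KS.filter fun A => ∃ Z ∈ 𝓜, #Z = z ∧ Z ⊆ A) : ℕ) : ℝ≥0∞) * ((n ^ z : ℕ) : ℝ≥0∞))
        ≤ ((#KS : ℕ) : ℝ≥0∞)⁻¹ * (((#KS : ℕ) : ℝ≥0∞) * (((Lw * d) ^ z : ℕ) : ℝ≥0∞)) := by
          refine mul_le_mul' le_rfl ?_
          have : #(KS.filter fun A => ∃ Z ∈ 𝓜, #Z = z ∧ Z ⊆ A) * n ^ z ≤ #KS * (Lw * d) ^ z := by
            calc _ ≤ Lw ^ z * (#KS * d ^ z) := hcnt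
              _ = #KS * (Lw * d) ^ z := by rw [mul_pow]; ring
          exact_mod_cast this
      _ = (((Lw * d) ^ z : ℕ) : ℝ≥0∞) := by rw [← mul_assoc, ENNReal.inv_mul_cancel hne htop, one_mul]
  calc ((#KS : ℕ) : ℝ≥0∞)⁻¹ * ((#(KS.filter fun A => ∃ Z ∈ 𝓜, z₀ ≤ #Z ∧ Z ⊆ A) : ℕ) : ℝ≥0∞)
      ≤ ((#KS : ℕ) : ℝ≥0∞)⁻¹ *
          ((#((Icc z₀ d).biUnion fun z => KS.filter fun A => ∃ Z ∈ 𝓜, #Z = z ∧ Z ⊆ A) : ℕ) : ℝ≥0∞) := by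
        gcongr
    _ ≤ ((#KS : ℕ) : ℝ≥0∞)⁻¹ *
          ∑ z ∈ Icc z₀ d, ((#(KS.filter fun A => ∃ Z ∈ 𝓜, #Z = z ∧ Z ⊆ A) : ℕ) : ℝ≥0∞) := by
        gcongr; exact_mod_cast card_biUnion_le
    _ = ∑ z ∈ Icc z₀ d, ((#KS : ℕ) : ℝ≥0∞)⁻¹ *
          ((#(KS.filter fun A => ∃ Z ∈ 𝓜, #Z = z ∧ Z ⊆ A) : ℕ) : ℝ≥0∞) := mul_sum _ _ _
    _ ≤ ∑ z ∈ Icc z₀ d, (((Lw * d) ^ z : ℕ) : ℝ≥0∞) / ((n ^ z : ℕ) : ℝ≥0∞) := sum_le_sum fun z _ => hslice z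
    _ ≤ 2 * ((((Lw * d) ^ z₀ : ℕ) : ℝ≥0∞) / ((n ^ z₀ : ℕ) : ℝ≥0∞)) := sum_Icc_pow_div_pow_le hn hsmall z₀ d

/-! ### The structure events in probability form -/

/-- **Bad₂ averaged.** The fraction of planted sets meeting some small clause (`#S < 2L'`) of `𝓒` in `≥ v₀` vertices is
`≤ #𝓒 (4 L' d)^{v₀} / n^{v₀}`. [folklore] -/
theorem depth3_avg_bad₂_le (hn : 0 < n) (𝓒 : Finset (Finset (⊤ : SimpleGraph (Fin n)).edgeSet)) (k L' v₀ : ℕ) :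
    ((#(kSubsets n k) : ℕ) : ℝ≥0∞)⁻¹ *
        ((#((kSubsets n k).filter fun A => ∃ S ∈ 𝓒, #S < 2 * L' ∧
          v₀ ≤ #(A ∩ univ.filter fun v : Fin n => ∃ e ∈ S, v ∈ (e : Sym2 (Fin n)))) : ℕ) : ℝ≥0∞) ≤
      (#𝓒 : ℝ≥0∞) * ((((4 * L' * min k n) ^ v₀ : ℕ) : ℝ≥0∞) / ((n ^ v₀ : ℕ) : ℝ≥0∞)) := by
  classical
  set KS := kSubsets n k with hKS
  have hne := card_kSubsets_cast_ne_zero n k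
  have htop : ((#KS : ℕ) : ℝ≥0∞) ≠ ⊤ := ENNReal.natCast_ne_top _
  have hcnt := depth3_card_kSubsets_bad₂_mul_le 𝓒 k L' v₀
  rw [← hKS] at hcnt
  have hnz : ((n ^ v₀ : ℕ) : ℝ≥0∞) ≠ 0 := by exact_mod_cast (pow_pos hn v₀).ne'
  rw [← mul_div_assoc, ENNReal.le_div_iff_mul_le (Or.inl hnz) (Or.inl (ENNReal.natCast_ne_top _)), mul_assoc]
  calc ((#KS : ℕ) : ℝ≥0∞)⁻¹ * (((#(KS.filter fun A => ∃ S ∈ 𝓒, #S < 2 * L' ∧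
          v₀ ≤ #(A ∩ univ.filter fun v : Fin n => ∃ e ∈ S, v ∈ (e : Sym2 (Fin n)))) : ℕ) : ℝ≥0∞) *
            ((n ^ v₀ : ℕ) : ℝ≥0∞))
      ≤ ((#KS : ℕ) : ℝ≥0∞)⁻¹ * (((#KS : ℕ) : ℝ≥0∞) * ((#𝓒 : ℝ≥0∞) * (((4 * L' * min k n) ^ v₀ : ℕ) : ℝ≥0∞))) := by
        refine mul_le_mul' le_rfl ?_
        have : #(KS.filter fun A => ∃ S ∈ 𝓒, #S < 2 * L' ∧
            v₀ ≤ #(A ∩ univ.filter fun v : Fin n => ∃ e ∈ S, v ∈ (e : Sym2 (Fin n)))) * n ^ v₀ ≤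
              #KS * (#𝓒 * (4 * L' * min k n) ^ v₀) := by
          calc _ ≤ #𝓒 * (#KS * (4 * L' * min k n) ^ v₀) := hcnt
            _ = #KS * (#𝓒 * (4 * L' * min k n) ^ v₀) := by ring
        exact_mod_cast this
    _ = (#𝓒 : ℝ≥0∞) * (((4 * L' * min k n) ^ v₀ : ℕ) : ℝ≥0∞) := by
        rw [← mul_assoc, ENNReal.inv_mul_cancel hne htop, one_mul]

/-- **A big clause needs rescue rarely (averaged).** For `2L' ≤ #S`, with `a = ⌊√#S⌋`, `d = min k n`, under the numeric
hypotheses of `depth3_choose_mul_pow_le`: the average over `A` of `Pr_x[S needs rescue for (A,x)]` is at most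
`(n^{2c+2})⁻¹ + 2⁻¹^{L'+1}`. [folklore] -/
theorem depth3_avg_rescue_big_le (hn : 0 < n) (k : ℕ) (S : Finset (⊤ : SimpleGraph (Fin n)).edgeSet)
    {L' M c : ℕ} (hbig : 2 * L' ≤ #S) (H2 : M * M ≤ 2 * L') (H3 : 18 * (min k n * min k n) ≤ n)
    (H4 : (18 * (min k n * min k n)) ^ M * n ^ (2 * c + 2) ≤ n ^ M) :
    ((#(kSubsets n k) : ℕ) : ℝ≥0∞)⁻¹ * ∑ A ∈ kSubsets n k, (erdosRenyiHalf n).toOuterMeasure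
        {x | ∀ e ∈ S, (¬ ∀ v ∈ (e : Sym2 (Fin n)), v ∈ A) → x e = false} ≤
      (((n ^ (2 * c + 2) : ℕ) : ℝ≥0∞))⁻¹ + (2⁻¹ : ℝ≥0∞) ^ (L' + 1) := by
  classical
  set KS := kSubsets n k with hKS
  set d := min k n with hd
  set V := univ.filter fun v : Fin n => ∃ e ∈ S, v ∈ (e : Sym2 (Fin n)) with hV
  set a := Nat.sqrt #S with ha
  have hne := card_kSubsets_cast_ne_zero n k
  have htop : ((#KS : ℕ) : ℝ≥0∞) ≠ ⊤ := ENNReal.natCast_ne_top _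
  -- per planted set: the dichotomy
  have hA : ∀ A ∈ KS, (erdosRenyiHalf n).toOuterMeasure
      {x | ∀ e ∈ S, (¬ ∀ v ∈ (e : Sym2 (Fin n)), v ∈ A) → x e = false} ≤
        (if a ≤ #(A ∩ V) then (1 : ℝ≥0∞) else 0) + (2⁻¹ : ℝ≥0∞) ^ (L' + 1) := by
    intro A _
    rcases depth3_rescue_dichotomy A S L' hbig with h | h
    · rw [← hV, ← ha] at h
      rw [if_pos h]
      exact le_add_right ((MeasureTheory.OuterMeasure.mono _ (Set.subset_univ _)).trans_eq
        ((PMF.toOuterMeasure_apply_eq_one_iff _ _).2 (Set.subset_univ _)))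
    · refine le_add_left (erdosRenyiHalf_le_half_pow_of_card_mul_le _ (L' + 1) ?_)
      simpa only [Set.mem_setOf_eq] using h
  -- average
  calc ((#KS : ℕ) : ℝ≥0∞)⁻¹ * ∑ A ∈ KS, (erdosRenyiHalf n).toOuterMeasure
          {x | ∀ e ∈ S, (¬ ∀ v ∈ (e : Sym2 (Fin n)), v ∈ A) → x e = false}
      ≤ ((#KS : ℕ) : ℝ≥0∞)⁻¹ * ∑ A ∈ KS, ((if a ≤ #(A ∩ V) then (1 : ℝ≥0∞) else 0) + (2⁻¹ : ℝ≥0∞) ^ (L' + 1)) := by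
        gcongr with A hAK; exact hA A hAK
    _ = ((#KS : ℕ) : ℝ≥0∞)⁻¹ * ∑ A ∈ KS, (if a ≤ #(A ∩ V) then (1 : ℝ≥0∞) else 0) + (2⁻¹ : ℝ≥0∞) ^ (L' + 1) := by
        rw [sum_add_distrib, mul_add, sum_const, nsmul_eq_mul, ← mul_assoc, ENNReal.inv_mul_cancel hne htop, one_mul]
    _ ≤ (((n ^ (2 * c + 2) : ℕ) : ℝ≥0∞))⁻¹ + (2⁻¹ : ℝ≥0∞) ^ (L' + 1) := by
        gcongr
        refine le_trans (avg_kSubsets_le_card_filter k _ (fun A => a ≤ #(A ∩ V)) fun A _ => le_rfl) ?_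
        by_cases had : a ≤ d
        · refine (avg_kSubsets_card_inter_ge_le hn k a V).trans ?_
          rw [← hd]
          refine natCast_div_le_inv_of_mul_le ?_ (pow_pos hn _).ne'
          calc (#V).choose a * d ^ a * n ^ (2 * c + 2) ≤ (2 * #S).choose a * d ^ a * n ^ (2 * c + 2) := by
                gcongr
                exact card_vertices_le_two_mul_card S
            _ ≤ n ^ a := depth3_choose_mul_pow_le hbig had H2 H3 H4
        · -- no planted set meets `V` in more than `d` vertices
          have hempty : (KS.filter fun A => a ≤ #(A ∩ V)) = ∅ := by
            refine filter_eq_empty_iff.2 fun A hAK hle => had (hle.trans ?_)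
            rw [hd, ← card_of_mem_kSubsets (by rw [← hKS]; exact hAK)]
            exact card_le_card inter_subset_left
          rw [← hKS, hempty, card_empty, Nat.cast_zero, mul_zero]
          exact bot_le

/-- **A clause with `≥ 2L'` slots is entirely off with probability `≤ 2⁻¹^{2L'}`.** [folklore] -/
theorem depth3_prob_allOff_le (S : Finset (⊤ : SimpleGraph (Fin n)).edgeSet) {L' : ℕ} (hbig : 2 * L' ≤ #S) :
    (erdosRenyiHalf n).toOuterMeasure {x : EdgeVec n | ∀ e ∈ S, x e = false} ≤ (2⁻¹ : ℝ≥0∞) ^ (2 * L') := by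
  classical
  refine erdosRenyiHalf_le_half_pow_of_card_mul_le _ (2 * L') ?_
  have h := depth3_card_allOff_mul_le S
  calc #(univ.filter fun x : EdgeVec n => x ∈ {x : EdgeVec n | ∀ e ∈ S, x e = false}) * 2 ^ (2 * L')
      ≤ #(univ.filter fun x : EdgeVec n => ∀ e ∈ S, x e = false) * 2 ^ #S := by
        refine Nat.mul_le_mul (le_of_eq ?_) (Nat.pow_le_pow_right two_pos hbig)
        rfl
    _ ≤ 2 ^ Fintype.card (⊤ : SimpleGraph (Fin n)).edgeSet := h

/-! ### Registered form -/

/-- **stub_depth3Avg** (registered side result of stmt-PneNP-18027, depth-3 line of seat 0; NOT a stub of the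
picked line's composition). [folklore] -/
theorem stub_depth3Avg : ∀ (n : ℕ), 0 < n → ∀ (𝒲 : Finset (Finset ((⊤ : SimpleGraph (Fin n)).edgeSet))) (τ : Finset (Fin n) → Prop), (∀ Z, τ Z ↔ ∀ S ∈ 𝒲, ∃ e ∈ S, ∀ v ∈ (e : Sym2 (Fin n)), v ∈ Z) → ∀ (𝓜 : Finset (Finset (Fin n))), (∀ Z, Z ∈ 𝓜 ↔ τ Z ∧ ∀ v ∈ Z, ¬ τ (Z.erase v)) → ∀ (Lw : ℕ), 1 ≤ Lw → (∀ S ∈ 𝒲, S.card ≤ Lw) → ∀ (k z₀ : ℕ), 2 * (Lw * min k n) ≤ n → ((kSubsets n k).card : ℝ≥0∞)⁻¹ * ((((kSubsets n k).filter fun A => ∃ Z ∈ 𝓜, z₀ ≤ Z.card ∧ Z ⊆ A).card : ℕ) : ℝ≥0∞) ≤ 2 * ((((Lw * min k n) ^ z₀ : ℕ) : ℝ≥0∞) / ((n ^ z₀ : ℕ) : ℝ≥0∞)) :=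
  fun _ hn 𝒲 τ hτ 𝓜 h𝓜 _ hLw hW k z₀ hsmall => depth3_avg_encoding_le hn 𝒲 τ hτ 𝓜 h𝓜 hLw hW k z₀ hsmall

end Summit.PneNP.PneNP.Theorems
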